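import Literature.Algebra.Polynomial.FischerDecomposition
import Mathlib.RingTheory.MvPolynomial.EulerIdentity
import Mathlib
import HarnessLib

/-!
# Hobson's formula, harmonic case: `H(∂) (r²)^m = 2^L · m(m-1)⋯(m-L+1) · (r²)^{m-L} · H`

**Theorem (Hobson; harmonic case).**  For a harmonic homogeneous polynomial `H` of degree `L` in finitely many variables and
the constant-coefficient differential operator `H(∂)` (`xᵢ ↦ ∂ᵢ`), and every `m ∈ ℕ`,
`H(∂) (Σᵢ xᵢ²)^m = 2^L · m^{(L)} · (Σᵢ xᵢ²)^{m-L} · H`, `m^{(L)} = m(m-1)⋯(m-L+1)` (zero when `m < L`).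
This is the `j = 0` term of Hobson's formula `p(∂) f(‖x‖) = Σ_j (2^j j!)⁻¹ [(r⁻¹ d/dr)^{m-j} f₀](‖x‖) Δ^j p(x)` for `p`
homogeneous of degree `m` [Hobson1955, p. 124]; for harmonic `p` only `j = 0` survives, and on `f₀(r) = r^{2m}` one has
`(r⁻¹d/dr)^L r^{2m} = 2^L m^{(L)} r^{2(m-L)}`.  It is the algebraic core of the Bochner–Hecke identity (Fourier transform of
`H(p)·e^{-s|p|²}`) and of Maxwell's representation of harmonics.

PROOF formalised (induction on `L` through the Euler operator, the route of arXiv:1804.01311 Thm 1): for `H` of degree `L+1`,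
Euler gives `H = (L+1)⁻¹ Σᵢ xᵢ ∂ᵢH`, so `H(∂) = (L+1)⁻¹ Σᵢ ∂ᵢ ∘ (∂ᵢH)(∂)`; the `∂ᵢH` are harmonic homogeneous of degree `L`, so by
induction `(∂ᵢH)(∂)(r²)^m = 2^L m^{(L)} (r²)^{m-L} ∂ᵢH`, and `Σᵢ ∂ᵢ[(r²)^k ∂ᵢH] = 2k (r²)^{k-1} Σᵢ xᵢ∂ᵢH + (r²)^k ΔH = 2k(L+1)(r²)^{k-1} H`.

The operator `H(∂)` is the algebra homomorphism `f ↦ ∂(f)` of the tree's Fischer file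
(`Literature.Algebra.Polynomial.FischerDecomposition.exists_algHom_pderiv`), passed as a hypothesis `D` with `D (X i) = ∂ᵢ` as there.
Main result: `algHom_pderiv_apply_sum_sq_pow_of_harmonic`.
-/

noncomputable section

open MvPolynomial
open scoped BigOperators

namespace Literature.Algebra.Polynomial

section Hobson

variable {ι : Type*} [Fintype ι]

/-- `∂ᵢ (Σⱼ xⱼ²) = 2 xᵢ`. [cite: Hobson1955, p. 124] -/
theorem pderiv_sum_X_sq (i : ι) : pderiv i (∑ j : ι, (X j : MvPolynomial ι ℝ) ^ 2) = 2 * X i := by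
  rw [map_sum, Finset.sum_eq_single i]
  · rw [Derivation.leibniz_pow, pderiv_X_self]
    simp [smul_eq_mul]
  · intro j _ hj
    rw [Derivation.leibniz_pow, pderiv_X_of_ne hj]
    simp
  · intro h; exact absurd (Finset.mem_univ i) h

/-- `Σᵢ ∂ᵢ [(r²)^k · ∂ᵢH] = 2k (r²)^{k-1} Σᵢ xᵢ ∂ᵢH + (r²)^k ΔH`. [cite: Hobson1955, p. 124] -/
theorem sum_pderiv_sum_X_sq_pow_mul_pderiv (H : MvPolynomial ι ℝ) (k : ℕ) :
    ∑ i : ι, pderiv i ((∑ j : ι, (X j : MvPolynomial ι ℝ) ^ 2) ^ k * pderiv i H) =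
      C (2 * (k : ℝ)) * (∑ j : ι, (X j : MvPolynomial ι ℝ) ^ 2) ^ (k - 1) * (∑ i : ι, X i * pderiv i H)
        + (∑ j : ι, (X j : MvPolynomial ι ℝ) ^ 2) ^ k * ∑ i : ι, pderiv i (pderiv i H) := by
  set r2 : MvPolynomial ι ℝ := ∑ j : ι, (X j : MvPolynomial ι ℝ) ^ 2 with hr2
  have hterm : ∀ i : ι, pderiv i (r2 ^ k * pderiv i H) =
      C (2 * (k : ℝ)) * r2 ^ (k - 1) * (X i * pderiv i H) + r2 ^ k * pderiv i (pderiv i H) := by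
    intro i
    rw [pderiv_mul, Derivation.leibniz_pow, pderiv_sum_X_sq]
    simp only [smul_eq_mul, nsmul_eq_mul, map_mul, map_natCast, map_ofNat]
    ring
  simp_rw [hterm]
  rw [Finset.sum_add_distrib, ← Finset.mul_sum, ← Finset.mul_sum]

/-- **Hobson's formula, harmonic case.**  For `H` harmonic (`Σᵢ ∂ᵢ²H = 0`) and homogeneous of degree `L`, with `D` the algebra
homomorphism `f ↦ ∂(f)` (`D (X i) = ∂ᵢ`): `D H ((Σᵢ xᵢ²)^m) = (2^L · m^{(L)}) • ((Σᵢ xᵢ²)^{m-L} · H)` for every `m` (`m^{(L)}` the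
descending factorial; both sides vanish for `m < L`). [cite: Hobson1955, p. 124] -/
theorem algHom_pderiv_apply_sum_sq_pow_of_harmonic
    (D : MvPolynomial ι ℝ →ₐ[ℝ] Module.End ℝ (MvPolynomial ι ℝ))
    (hD : ∀ i, D (X i) =
      ((pderiv i : Derivation ℝ (MvPolynomial ι ℝ) (MvPolynomial ι ℝ)) : Module.End ℝ (MvPolynomial ι ℝ))) :
    ∀ (L : ℕ) (H : MvPolynomial ι ℝ), H.IsHomogeneous L → (∑ i : ι, pderiv i (pderiv i H)) = 0 → ∀ m : ℕ,
      D H ((∑ j : ι, (X j : MvPolynomial ι ℝ) ^ 2) ^ m) =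
        ((2 : ℝ) ^ L * (m.descFactorial L : ℝ)) • ((∑ j : ι, (X j : MvPolynomial ι ℝ) ^ 2) ^ (m - L) * H) := by
  intro L
  induction L with
  | zero =>
    intro H hH _ m
    -- `H` is a constant
    have hC : H = C (coeff 0 H) := by
      rw [← totalDegree_zero_iff_isHomogeneous, totalDegree_eq_zero_iff_eq_C] at hH
      exact hH
    rw [hC, ← MvPolynomial.algebraMap_eq, AlgHom.commutes, Module.algebraMap_end_apply, MvPolynomial.algebraMap_eq]
    simp only [pow_zero, Nat.descFactorial_zero, Nat.cast_one, mul_one, one_smul, Nat.sub_zero]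
    rw [mul_comm, C_mul']
  | succ L ih =>
    intro H hH hΔ m
    classical
    set r2 : MvPolynomial ι ℝ := ∑ j : ι, (X j : MvPolynomial ι ℝ) ^ 2 with hr2
    have hL1 : ((L + 1 : ℕ) : ℝ) ≠ 0 := by positivity
    -- Euler: `Σ xᵢ ∂ᵢH = (L+1) H`
    have hE : ∑ i : ι, X i * pderiv i H = ((L + 1 : ℕ) : ℝ) • H := by
      rw [hH.sum_X_mul_pderiv, Nat.cast_smul_eq_nsmul]
    -- the `∂ᵢH` are harmonic, homogeneous of degree `L`
    have hdh : ∀ i, (pderiv i H).IsHomogeneous L := fun i => by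
      simpa using (hH.pderiv (i := i))
    have hdΔ : ∀ i, (∑ j : ι, pderiv j (pderiv j (pderiv i H))) = 0 := by
      intro i
      have : ∀ j, pderiv j (pderiv j (pderiv i H)) = pderiv i (pderiv j (pderiv j H)) := fun j => by
        rw [pderiv_pderiv_comm j i, pderiv_pderiv_comm j i]
      simp_rw [this]
      rw [← map_sum, hΔ, map_zero]
    have hIH : ∀ i, D (pderiv i H) (r2 ^ m) =
        ((2 : ℝ) ^ L * (m.descFactorial L : ℝ)) • (r2 ^ (m - L) * pderiv i H) := fun i =>
      ih (pderiv i H) (hdh i) (hdΔ i) m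
    -- `D H = (L+1)⁻¹ Σᵢ ∂ᵢ ∘ D(∂ᵢH)`
    have hH' : H = ((L + 1 : ℕ) : ℝ)⁻¹ • ∑ i : ι, X i * pderiv i H := by
      rw [hE, smul_smul, inv_mul_cancel₀ hL1, one_smul]
    have hDH : D H (r2 ^ m) = ((L + 1 : ℕ) : ℝ)⁻¹ • ∑ i : ι, pderiv i (D (pderiv i H) (r2 ^ m)) := by
      conv_lhs => rw [hH']
      rw [map_smul, map_sum, LinearMap.smul_apply, LinearMap.sum_apply]
      congr 1
      refine Finset.sum_congr rfl fun i _ => ?_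
      rw [map_mul, Module.End.mul_apply, hD i]
      rfl
    rw [hDH]
    simp_rw [hIH, Derivation.map_smul]
    rw [← Finset.smul_sum, sum_pderiv_sum_X_sq_pow_mul_pderiv H (m - L), hΔ, mul_zero, add_zero, hE, smul_smul]
    -- collect the scalars
    rw [show C (2 * ((m - L : ℕ) : ℝ)) * r2 ^ (m - L - 1) * (((L + 1 : ℕ) : ℝ) • H) =
        (2 * ((m - L : ℕ) : ℝ) * ((L + 1 : ℕ) : ℝ)) • (r2 ^ (m - (L + 1)) * H) by
      rw [show m - L - 1 = m - (L + 1) by omega, mul_smul_comm, C_mul', smul_mul_assoc, smul_smul,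
        mul_comm (((L + 1 : ℕ) : ℝ))]]
    rw [smul_smul]
    congr 1
    -- the numerical identity `(L+1)⁻¹ · 2^L m^{(L)} · 2 (m-L) (L+1) = 2^{L+1} m^{(L+1)}`
    rw [Nat.descFactorial_succ, Nat.cast_mul, pow_succ]
    by_cases hmL : L ≤ m
    · rw [Nat.cast_sub hmL]
      field_simp
    · have h0 : m.descFactorial L = 0 := Nat.descFactorial_eq_zero_iff_lt.2 (by omega)
      have h1 : m - L = 0 := by omega
      simp [h0, h1]

/-- **Hobson's formula for any polynomial profile of `r²` (harmonic case)**: for `H` harmonic homogeneous of degree `L` and a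
univariate polynomial `q`, `D H (q(Σᵢ xᵢ²)) = 2^L • (H · q^{(L)}(Σᵢ xᵢ²))` with `q^{(L)}` the `L`-th derivative — by linearity from the
monomial case (`(d/dt)^L t^m = m^{(L)} t^{m-L}`). [cite: Hobson1955, p. 124] -/
theorem algHom_pderiv_apply_aeval_sum_sq_of_harmonic
    (D : MvPolynomial ι ℝ →ₐ[ℝ] Module.End ℝ (MvPolynomial ι ℝ))
    (hD : ∀ i, D (X i) =
      ((pderiv i : Derivation ℝ (MvPolynomial ι ℝ) (MvPolynomial ι ℝ)) : Module.End ℝ (MvPolynomial ι ℝ)))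
    {L : ℕ} {H : MvPolynomial ι ℝ} (hH : H.IsHomogeneous L) (hΔ : (∑ i : ι, pderiv i (pderiv i H)) = 0)
    (q : Polynomial ℝ) :
    D H (Polynomial.aeval (∑ j : ι, (X j : MvPolynomial ι ℝ) ^ 2) q) =
      ((2 : ℝ) ^ L) • (H * Polynomial.aeval (∑ j : ι, (X j : MvPolynomial ι ℝ) ^ 2) (Polynomial.derivative^[L] q)) := by
  induction q using Polynomial.induction_on' with
  | add p q hp hq =>
    have hadd : Polynomial.derivative^[L] (p + q) = Polynomial.derivative^[L] p + Polynomial.derivative^[L] q := by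
      simp_rw [← Module.End.pow_apply, map_add]
    rw [map_add, map_add, hp, hq, hadd, map_add, mul_add, smul_add]
  | monomial n a =>
    rw [← Polynomial.C_mul_X_pow_eq_monomial, Polynomial.iterate_derivative_C_mul,
      Polynomial.iterate_derivative_X_pow_eq_smul]
    simp only [map_mul, map_pow, Polynomial.aeval_C, Polynomial.aeval_X, map_smul, MvPolynomial.algebraMap_eq]
    rw [C_mul', map_smul, algHom_pderiv_apply_sum_sq_pow_of_harmonic D hD L H hH hΔ n]
    simp only [smul_eq_C_mul, map_mul, map_natCast, map_pow]
    ring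

end Hobson

end Literature.Algebra.Polynomial

end
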